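import Summits.QuantumFields.YangMills.Theorems.LuscherReductionTwistedTraceScalingBODefectTailRate
import Summits.QuantumFields.YangMills.Theorems.LuscherReductionTwistedTraceScalingBODefectShellRate
import Summits.QuantumFields.YangMills.Theorems.FlatTubeReductionDefectRatesSq
import HarnessLib

/-!
# The three super-polynomial defect pieces over the polynomial currency floors are `o(λ_b²)` — general cap constant

Support file for the crux `NearFlatRatioLaw` (line `ratepack_v2`, stub `stub_hODpot_A`; successor step (E3) of memo v8 (g19)): the `bareLambda²` twins of lane A's
`…BODefectPieceRates.piece_rate_small`, `…BODefectTailRate.tail_rate_small`, `…BODefectOutRate.out_rate_small`, `…BODefectShellRate.shell_rate_small`, with the cap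
constant `43` of `κ_P = C_p(43β^{-s})²` a parameter `Kc` (proofs VERBATIM; the last step is `…DefectRatesSq.sq_rate_small_sq_of_exp_btLog_sq`).
* `piece_rate_small_sq`, ★★ `tail_rate_small_sq_K`, ★★ `out_rate_small_sq_K`, ★★ `shell_rate_small_sq_K` — `∀ a > 0, ∀ᶠ β, X_piece(β)/(c_R·β^{-K}·e^{4β|E|}) ≤ a·bareLambda(L³β)²`.
-/

set_option autoImplicit false

noncomputable section

open MeasureTheory Filter Topology Real
open Literature.MathematicalPhysics.QuantumFieldTheory
open Literature.MathematicalPhysics.QuantumLattice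

namespace Summit.QuantumFields.YangMills.Theorems.FemtoTransferGap.TwoLattice.ConstTube

open Summit.QuantumFields.YangMills.Theorems.FemtoTransferGap
open Summit.QuantumFields.YangMills.Theorems.FemtoTransferGap.TwoLattice
open Summit.QuantumFields.YangMills.Theorems.FemtoTransferGap.TwoLattice.Stiff
open Summit.QuantumFields.YangMills.Theorems.FemtoTransferGap.TwoLattice.GnChart
open Summit.QuantumFields.YangMills.Theorems.FemtoTransferGap.TwoLattice.Toron (gap_pos)

variable {L : ℕ} [NeZero L]

/-- ★ **A super-polynomially small piece over a polynomial floor is `o(λ_b²)`**: the `bareLambda²` twin of `…BODefectPieceRates.piece_rate_small`. [folklore] -/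
theorem piece_rate_small_sq {X Q : ℝ → ℝ} {q P cR : ℝ} (hq : 0 < q) (hP : 0 ≤ P) (hcR : 0 < cR) (m K : ℕ)
    (hX : ∀ᶠ β : ℝ in atTop, X β ≤ (Real.exp (2 * β) ^ Fintype.card (Edge 3 L)) ^ 2 * Q β * Real.exp (-(q * btLog β ^ 2)))
    (hQ : ∀ᶠ β : ℝ in atTop, 0 ≤ Q β ∧ Q β ≤ P / powScale 1 β ^ m) :
    ∀ a : ℝ, 0 < a → ∀ᶠ β : ℝ in atTop,
      X β / (cR * powScale 1 β ^ K * (Real.exp (2 * β) ^ Fintype.card (Edge 3 L)) ^ 2) ≤ a * bareLambda ((L : ℝ) ^ 3 * β) ^ 2 := by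
  set F : ℝ → ℝ := fun β => cR * powScale 1 β ^ K * (Real.exp (2 * β) ^ Fintype.card (Edge 3 L)) ^ 2 with hF
  set b : ℝ → ℝ := fun β => Real.sqrt (max 0 (X β / F β)) with hb
  -- `b² = max 0 (X/F) ≤ (P/c_R)·e^{−qℓ²}/ps1^{m+K}` eventually
  have hb2 : ∀ᶠ β : ℝ in atTop, b β ^ 2 ≤ P / cR * Real.exp (-(q * btLog β ^ 2)) / powScale 1 β ^ (m + K) := by
    filter_upwards [hX, hQ] with β hXβ ⟨hQ0, hQβ⟩
    have hps : 0 < powScale 1 β := powScale_pos 1 β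
    set EK2 : ℝ := (Real.exp (2 * β) ^ Fintype.card (Edge 3 L)) ^ 2 with hEK2
    have hEK0 : 0 < EK2 := by positivity
    have hF0 : 0 < F β := by simp only [hF]; positivity
    have hrhs0 : 0 ≤ P / cR * Real.exp (-(q * btLog β ^ 2)) / powScale 1 β ^ (m + K) := by positivity
    rw [hb, Real.sq_sqrt (le_max_left _ _), max_le_iff]
    refine ⟨hrhs0, ?_⟩
    rw [div_le_iff₀ hF0]
    calc X β ≤ EK2 * Q β * Real.exp (-(q * btLog β ^ 2)) := hXβ
      _ ≤ EK2 * (P / powScale 1 β ^ m) * Real.exp (-(q * btLog β ^ 2)) :=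
          mul_le_mul_of_nonneg_right (mul_le_mul_of_nonneg_left hQβ hEK0.le) (Real.exp_pos _).le
      _ = P / cR * Real.exp (-(q * btLog β ^ 2)) / powScale 1 β ^ (m + K) * F β := by
          simp only [hF, hEK2]; rw [pow_add]; field_simp
  have hsmall := sq_rate_small_sq_of_exp_btLog_sq (L := L) hq (div_nonneg hP hcR.le) (m + K) (b := b)
    (by filter_upwards [hb2] with β h; rw [mul_div_assoc] at h ⊢; simpa [mul_div_assoc, div_div, mul_comm, mul_left_comm, mul_assoc] using h)
  intro a ha
  filter_upwards [hsmall a ha] with β hβ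
  have h1 : X β / F β ≤ b β ^ 2 := by rw [hb, Real.sq_sqrt (le_max_left _ _)]; exact le_max_right _ _
  exact h1.trans hβ

set_option maxHeartbeats 800000 in
-- explicit record expressions.
/-- ★★ **THE FP-TAIL PIECE IS `o(λ_bare)` OVER THE CURRENCY FLOOR** (see the module docstring): given the two tail-schedule bounds eventually (`…BODefectTailSchedule`),
the coefficient `X_tail²·c_g` over `c_R·β^{-K}·e^{4β|E|}` is eventually `≤ a·bareLambda(L³β)` for every `a > 0`. [cite: Luscher1983, §3] -/
theorem tail_rate_small_sq_K {s : ℝ} (hs : 0 < s) (Kc Cp Dδ : ℝ) {q₀ : ℝ} (hq₀ : 0 < q₀) {cR : ℝ} (hcR : 0 < cR) (K : ℕ)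
    (hsched : ∀ᶠ β : ℝ in atTop, Real.log β ^ 4 / 4 ≤ β * btMnt L (Dδ * powScale s β) (powScale (1 / 2) β * btLog β ^ 2) (min (1 / 40) (powScale (1 / 2) β * btLog β)) (5 * (powScale (1 / 2) β * btLog β ^ 2)) (powScale 1 β) ∧
      q₀ * Real.log β ^ 4 ≤ β * btMfar L (Dδ * powScale s β) (powScale (1 / 2) β * btLog β ^ 2) (min (1 / 40) (powScale (1 / 2) β * btLog β)) (powScale 1 β) (13 * (Dδ * powScale s β))) :
    ∀ a : ℝ, 0 < a → ∀ᶠ β : ℝ in atTop,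
      ((Real.exp (β * (2 * (Fintype.card (Edge 3 L) : ℝ))) * (Real.exp (-(β * btMnt L (Dδ * powScale s β) (powScale (1 / 2) β * btLog β ^ 2) (min (1 / 40) (powScale (1 / 2) β * btLog β)) (5 * (powScale (1 / 2) β * btLog β ^ 2)) (powScale 1 β))) + Real.exp (-(β * btMfar L (Dδ * powScale s β) (powScale (1 / 2) β * btLog β ^ 2) (min (1 / 40) (powScale (1 / 2) β * btLog β)) (powScale 1 β) (13 * (Dδ * powScale s β))))) * ∫ v, (fun x : LinkSpace L => {x : LinkSpace L | linkCurry x ∈ capBalancedSet L}.indicator (fun _ => (1 : ℝ)) x * frozenProfile L (fun β' => stiffGaussExp L (β' / 2) β') (fun β' => min (1 / 40) (powScale (1 / 2) β' * btLog β')) β x) (linkEmbed L v) ∂orthoTransverse L) ^ 2 * (1 / (fpWeightBar L (powScale 1 β) * (1 - Cp * (Kc * powScale s β) ^ 2)))) /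
        (cR * powScale 1 β ^ K * (Real.exp (2 * β) ^ Fintype.card (Edge 3 L)) ^ 2) ≤ a * bareLambda ((L : ℝ) ^ 3 * β) ^ 2 := by
  haveI := isFiniteMeasure_orthoTransverse L
  set q : ℝ := min (1 / 4) q₀ with hqdef
  have hq0 : 0 < q := lt_min (by norm_num) hq₀
  have hq1 : q ≤ 1 / 4 := min_le_left _ _
  have hq2 : q ≤ q₀ := min_le_right _ _
  set Pm : ℝ := (orthoTransverse L Set.univ).toReal with hPm
  have hPm0 : 0 ≤ Pm := ENNReal.toReal_nonneg
  set c₀i : ℝ := Real.sqrt (gramDet L 0) / ((2 * π ^ 2)⁻¹) ^ Fintype.card (NzSite L) with hc₀i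
  have hc₀i0 : 0 ≤ c₀i := by rw [hc₀i]; positivity
  set Q : ℝ → ℝ := fun β => 4 * Pm ^ 2 * (1 / (fpWeightBar L (powScale 1 β) * (1 - Cp * (Kc * powScale s β) ^ 2))) with hQ
  have hκ : ∀ᶠ β : ℝ in atTop, Cp * (Kc * powScale s β) ^ 2 ≤ 1 / 2 := by
    have h := ((tendsto_powScale hs).const_mul Kc).pow 2 |>.const_mul Cp
    rw [mul_zero, zero_pow two_ne_zero, mul_zero] at h
    exact h.eventually (eventually_le_nhds (by norm_num))
  refine piece_rate_small_sq (L := L) hq0 (P := 4 * Pm ^ 2 * (2 * c₀i)) (by positivity) hcR (flatDim L) K (Q := Q) ?_ ?_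
  · filter_upwards [hsched, hκ, exp_neg_log_four_le, exp_neg_mul_log_four_le hq₀.le] with β ⟨hnt, hfar⟩ hκβ hl4 hl4q
    set EK : ℝ := Real.exp (2 * β) ^ Fintype.card (Edge 3 L) with hEK
    have hN : 0 < fpWeightBar L (powScale 1 β) := fpWeightBar_pos L (powScale_pos 1 β)
    have hcg0 : 0 ≤ 1 / (fpWeightBar L (powScale 1 β) * (1 - Cp * (Kc * powScale s β) ^ 2)) := by
      apply div_nonneg zero_le_one; apply mul_nonneg hN.le; linarith
    obtain ⟨hI0, hI1⟩ := integral_recordOmega_le (L := L) β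
    have hℓ : 0 ≤ btLog β ^ 2 := sq_nonneg _
    set X : ℝ := Real.exp (-(q * btLog β ^ 2)) with hX
    -- the two exponentials
    have e1 : Real.exp (-(β * btMnt L (Dδ * powScale s β) (powScale (1 / 2) β * btLog β ^ 2) (min (1 / 40) (powScale (1 / 2) β * btLog β)) (5 * (powScale (1 / 2) β * btLog β ^ 2)) (powScale 1 β))) ≤ X := by
      refine le_trans ?_ (hl4.trans ?_)
      · rw [Real.exp_le_exp, neg_le_neg_iff]; exact hnt
      · rw [hX, Real.exp_le_exp, neg_le_neg_iff]; exact mul_le_mul_of_nonneg_right hq1 hℓ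
    have e2 : Real.exp (-(β * btMfar L (Dδ * powScale s β) (powScale (1 / 2) β * btLog β ^ 2) (min (1 / 40) (powScale (1 / 2) β * btLog β)) (powScale 1 β) (13 * (Dδ * powScale s β)))) ≤ X := by
      refine le_trans ?_ (hl4q.trans ?_)
      · rw [Real.exp_le_exp, neg_le_neg_iff]; exact hfar
      · rw [hX, Real.exp_le_exp, neg_le_neg_iff]; exact mul_le_mul_of_nonneg_right hq2 hℓ
    have hX0 : 0 ≤ X := (Real.exp_pos _).le
    have hX1 : X ≤ 1 := Real.exp_le_one_iff.mpr (by nlinarith)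
    have hsum0 : 0 ≤ Real.exp (-(β * btMnt L (Dδ * powScale s β) (powScale (1 / 2) β * btLog β ^ 2) (min (1 / 40) (powScale (1 / 2) β * btLog β)) (5 * (powScale (1 / 2) β * btLog β ^ 2)) (powScale 1 β))) + Real.exp (-(β * btMfar L (Dδ * powScale s β) (powScale (1 / 2) β * btLog β ^ 2) (min (1 / 40) (powScale (1 / 2) β * btLog β)) (powScale 1 β) (13 * (Dδ * powScale s β)))) := by positivity
    have hsum : Real.exp (-(β * btMnt L (Dδ * powScale s β) (powScale (1 / 2) β * btLog β ^ 2) (min (1 / 40) (powScale (1 / 2) β * btLog β)) (5 * (powScale (1 / 2) β * btLog β ^ 2)) (powScale 1 β))) + Real.exp (-(β * btMfar L (Dδ * powScale s β) (powScale (1 / 2) β * btLog β ^ 2) (min (1 / 40) (powScale (1 / 2) β * btLog β)) (powScale 1 β) (13 * (Dδ * powScale s β)))) ≤ 2 * X := by linarith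
    have hE : Real.exp (β * (2 * (Fintype.card (Edge 3 L) : ℝ))) = EK := exp_two_pow_card_edge' (L := L) β
    -- `X_tail ≤ EK·2X·Pm`, so `X_tail² ≤ EK²·4X²Pm² ≤ EK²·4Pm²·X`
    have hXT0 : 0 ≤ (Real.exp (β * (2 * (Fintype.card (Edge 3 L) : ℝ))) * (Real.exp (-(β * btMnt L (Dδ * powScale s β) (powScale (1 / 2) β * btLog β ^ 2) (min (1 / 40) (powScale (1 / 2) β * btLog β)) (5 * (powScale (1 / 2) β * btLog β ^ 2)) (powScale 1 β))) + Real.exp (-(β * btMfar L (Dδ * powScale s β) (powScale (1 / 2) β * btLog β ^ 2) (min (1 / 40) (powScale (1 / 2) β * btLog β)) (powScale 1 β) (13 * (Dδ * powScale s β))))) * ∫ v, (fun x : LinkSpace L => {x : LinkSpace L | linkCurry x ∈ capBalancedSet L}.indicator (fun _ => (1 : ℝ)) x * frozenProfile L (fun β' => stiffGaussExp L (β' / 2) β') (fun β' => min (1 / 40) (powScale (1 / 2) β' * btLog β')) β x) (linkEmbed L v) ∂orthoTransverse L) := by positivity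
    have hXT : (Real.exp (β * (2 * (Fintype.card (Edge 3 L) : ℝ))) * (Real.exp (-(β * btMnt L (Dδ * powScale s β) (powScale (1 / 2) β * btLog β ^ 2) (min (1 / 40) (powScale (1 / 2) β * btLog β)) (5 * (powScale (1 / 2) β * btLog β ^ 2)) (powScale 1 β))) + Real.exp (-(β * btMfar L (Dδ * powScale s β) (powScale (1 / 2) β * btLog β ^ 2) (min (1 / 40) (powScale (1 / 2) β * btLog β)) (powScale 1 β) (13 * (Dδ * powScale s β))))) * ∫ v, (fun x : LinkSpace L => {x : LinkSpace L | linkCurry x ∈ capBalancedSet L}.indicator (fun _ => (1 : ℝ)) x * frozenProfile L (fun β' => stiffGaussExp L (β' / 2) β') (fun β' => min (1 / 40) (powScale (1 / 2) β' * btLog β')) β x) (linkEmbed L v) ∂orthoTransverse L) ≤ EK * (2 * X) * Pm := by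
      rw [hE]; exact mul_le_mul (mul_le_mul_of_nonneg_left hsum (by positivity)) hI1 hI0 (by positivity)
    have hXT2 : (Real.exp (β * (2 * (Fintype.card (Edge 3 L) : ℝ))) * (Real.exp (-(β * btMnt L (Dδ * powScale s β) (powScale (1 / 2) β * btLog β ^ 2) (min (1 / 40) (powScale (1 / 2) β * btLog β)) (5 * (powScale (1 / 2) β * btLog β ^ 2)) (powScale 1 β))) + Real.exp (-(β * btMfar L (Dδ * powScale s β) (powScale (1 / 2) β * btLog β ^ 2) (min (1 / 40) (powScale (1 / 2) β * btLog β)) (powScale 1 β) (13 * (Dδ * powScale s β))))) * ∫ v, (fun x : LinkSpace L => {x : LinkSpace L | linkCurry x ∈ capBalancedSet L}.indicator (fun _ => (1 : ℝ)) x * frozenProfile L (fun β' => stiffGaussExp L (β' / 2) β') (fun β' => min (1 / 40) (powScale (1 / 2) β' * btLog β')) β x) (linkEmbed L v) ∂orthoTransverse L) ^ 2 ≤ EK ^ 2 * (4 * Pm ^ 2) * X := by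
      have h1 := pow_le_pow_left₀ hXT0 hXT 2
      have h2 : (EK * (2 * X) * Pm) ^ 2 = EK ^ 2 * (4 * Pm ^ 2) * (X * X) := by ring
      have h3 : X * X ≤ X := by nlinarith
      calc _ ≤ (EK * (2 * X) * Pm) ^ 2 := h1
        _ = EK ^ 2 * (4 * Pm ^ 2) * (X * X) := h2
        _ ≤ EK ^ 2 * (4 * Pm ^ 2) * X := mul_le_mul_of_nonneg_left h3 (by positivity)
    calc (Real.exp (β * (2 * (Fintype.card (Edge 3 L) : ℝ))) * (Real.exp (-(β * btMnt L (Dδ * powScale s β) (powScale (1 / 2) β * btLog β ^ 2) (min (1 / 40) (powScale (1 / 2) β * btLog β)) (5 * (powScale (1 / 2) β * btLog β ^ 2)) (powScale 1 β))) + Real.exp (-(β * btMfar L (Dδ * powScale s β) (powScale (1 / 2) β * btLog β ^ 2) (min (1 / 40) (powScale (1 / 2) β * btLog β)) (powScale 1 β) (13 * (Dδ * powScale s β))))) * ∫ v, (fun x : LinkSpace L => {x : LinkSpace L | linkCurry x ∈ capBalancedSet L}.indicator (fun _ => (1 : ℝ)) x * frozenProfile L (fun β' => stiffGaussExp L (β'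 / 2) β') (fun β' => min (1 / 40) (powScale (1 / 2) β' * btLog β')) β x) (linkEmbed L v) ∂orthoTransverse L) ^ 2 * (1 / (fpWeightBar L (powScale 1 β) * (1 - Cp * (Kc * powScale s β) ^ 2)))
        ≤ EK ^ 2 * (4 * Pm ^ 2) * X * (1 / (fpWeightBar L (powScale 1 β) * (1 - Cp * (Kc * powScale s β) ^ 2))) := mul_le_mul_of_nonneg_right hXT2 hcg0
      _ = EK ^ 2 * Q β * X := by simp only [hQ]; ring
  · filter_upwards [hκ] with β hκβ
    have hN : 0 < fpWeightBar L (powScale 1 β) := fpWeightBar_pos L (powScale_pos 1 β)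
    have hps : 0 < powScale 1 β := powScale_pos 1 β
    have h1κ : 1 / 2 ≤ 1 - Cp * (Kc * powScale s β) ^ 2 := by linarith
    have hcg : 1 / (fpWeightBar L (powScale 1 β) * (1 - Cp * (Kc * powScale s β) ^ 2)) ≤ 2 * c₀i / powScale 1 β ^ flatDim L := by
      have hi := inv_fpWeightBar_le (L := L) β
      rw [← hc₀i] at hi
      calc 1 / (fpWeightBar L (powScale 1 β) * (1 - Cp * (Kc * powScale s β) ^ 2)) ≤ 1 / (fpWeightBar L (powScale 1 β) * (1 / 2)) :=
            one_div_le_one_div_of_le (by positivity) (mul_le_mul_of_nonneg_left h1κ hN.le)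
        _ = 2 * (1 / fpWeightBar L (powScale 1 β)) := by field_simp
        _ ≤ 2 * (c₀i / powScale 1 β ^ flatDim L) := by linarith
        _ = 2 * c₀i / powScale 1 β ^ flatDim L := by ring
    refine ⟨by simp only [hQ]; positivity, ?_⟩
    calc Q β = 4 * Pm ^ 2 * (1 / (fpWeightBar L (powScale 1 β) * (1 - Cp * (Kc * powScale s β) ^ 2))) := rfl
      _ ≤ 4 * Pm ^ 2 * (2 * c₀i / powScale 1 β ^ flatDim L) := by gcongr
      _ = 4 * Pm ^ 2 * (2 * c₀i) / powScale 1 β ^ flatDim L := by field_simp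


set_option maxHeartbeats 800000 in
-- explicit record expressions.
/-- ★★ **THE OUTER PIECE IS `o(λ_bare)` OVER THE CURRENCY FLOOR** (see the module docstring). [cite: Luscher1983, §3] -/
theorem out_rate_small_sq_K (hL : 2 ≤ L) {s : ℝ} (hs : 0 < s) (Kc Cp : ℝ) {cR : ℝ} (hcR : 0 < cR) (K : ℕ) :
    ∀ a : ℝ, 0 < a → ∀ᶠ β : ℝ in atTop,
      (3 * ((orthoTransverse L Set.univ).toReal * (1 / (fpWeightBar L (powScale 1 β) * (1 - Cp * (Kc * powScale s β) ^ 2))) *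
        ((Real.exp (2 * β) ^ Fintype.card (Edge 3 L)) ^ 2 * (Real.exp (-(β * (2 - 2 * Real.cos (2 * Real.pi / L)) * ((min (1 / 40) (powScale (1 / 2) β * btLog β)) / 12 / 2) ^ 2)) +
            Real.exp (-(((powScale 1 β) * btLog β) ^ 2 / powScale 1 β ^ 2)) ^ 2 + Real.exp (-(((powScale 1 β) * btLog β) ^ 2 / powScale 1 β ^ 2))) +
          Real.exp (2 * β) ^ Fintype.card (Edge 3 L) * (Real.exp (2 * β) ^ Fintype.card (Edge 3 L) * Real.exp (-(β * ((min (1 / 40) (powScale (1 / 2) β * btLog β)) / 1000) ^ 2)))))) /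
        (cR * powScale 1 β ^ K * (Real.exp (2 * β) ^ Fintype.card (Edge 3 L)) ^ 2) ≤ a * bareLambda ((L : ℝ) ^ 3 * β) ^ 2 := by
  haveI := isFiniteMeasure_orthoTransverse L
  set gap : ℝ := 2 - 2 * Real.cos (2 * Real.pi / L) with hgap
  have hgap0 : 0 < gap := gap_pos L hL
  set q : ℝ := min (gap / 576) (1 / 1000000) with hqdef
  have hq0 : 0 < q := lt_min (by positivity) (by norm_num)
  have hq1 : q ≤ gap / 576 := min_le_left _ _
  have hq2 : q ≤ 1 / 1000000 := min_le_right _ _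
  set Pm : ℝ := (orthoTransverse L Set.univ).toReal with hPm
  have hPm0 : 0 ≤ Pm := ENNReal.toReal_nonneg
  set c₀i : ℝ := Real.sqrt (gramDet L 0) / ((2 * π ^ 2)⁻¹) ^ Fintype.card (NzSite L) with hc₀i
  have hc₀i0 : 0 ≤ c₀i := by rw [hc₀i]; positivity
  -- `Q β = 3·π(univ)·c_g·4`
  set Q : ℝ → ℝ := fun β => 3 * (Pm * (1 / (fpWeightBar L (powScale 1 β) * (1 - Cp * (Kc * powScale s β) ^ 2)))) * 4 with hQ
  have hκ : ∀ᶠ β : ℝ in atTop, Cp * (Kc * powScale s β) ^ 2 ≤ 1 / 2 := by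
    have h := ((tendsto_powScale hs).const_mul Kc).pow 2 |>.const_mul Cp
    rw [mul_zero, zero_pow two_ne_zero, mul_zero] at h
    exact h.eventually (eventually_le_nhds (by norm_num))
  refine piece_rate_small_sq (L := L) hq0 (P := 3 * (Pm * (2 * c₀i)) * 4) (by positivity) hcR (flatDim L) K (Q := Q) ?_ ?_
  · -- `X_O ≤ EK²·Q·e^{−qℓ²}`
    filter_upwards [eventually_beta_mul_rf_sq, hκ, eventually_ge_atTop (1 : ℝ)] with β hrf hκβ hβ1
    set EK : ℝ := Real.exp (2 * β) ^ Fintype.card (Edge 3 L) with hEK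
    have hEK0 : 0 < EK := by positivity
    have hN : 0 < fpWeightBar L (powScale 1 β) := fpWeightBar_pos L (powScale_pos 1 β)
    have hcg0 : 0 ≤ 1 / (fpWeightBar L (powScale 1 β) * (1 - Cp * (Kc * powScale s β) ^ 2)) := by
      apply div_nonneg zero_le_one; apply mul_nonneg hN.le; linarith
    have hℓ : 0 ≤ btLog β ^ 2 := sq_nonneg _
    have hps : 0 < powScale 1 β := powScale_pos 1 β
    -- the four exponentials
    have e1 : Real.exp (-(β * gap * ((min (1 / 40) (powScale (1 / 2) β * btLog β)) / 12 / 2) ^ 2)) ≤ Real.exp (-(q * btLog β ^ 2)) := by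
      rw [Real.exp_le_exp, neg_le_neg_iff]
      have : β * gap * ((min (1 / 40) (powScale (1 / 2) β * btLog β)) / 12 / 2) ^ 2 = gap / 576 * (β * (min (1 / 40) (powScale (1 / 2) β * btLog β)) ^ 2) := by ring
      rw [this, hrf]
      exact mul_le_mul_of_nonneg_right hq1 hℓ
    have eτ : ((powScale 1 β) * btLog β) ^ 2 / powScale 1 β ^ 2 = btLog β ^ 2 := by field_simp
    have e2 : Real.exp (-(((powScale 1 β) * btLog β) ^ 2 / powScale 1 β ^ 2)) ≤ Real.exp (-(q * btLog β ^ 2)) := by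
      rw [eτ, Real.exp_le_exp, neg_le_neg_iff]; nlinarith
    have e2' : Real.exp (-(((powScale 1 β) * btLog β) ^ 2 / powScale 1 β ^ 2)) ^ 2 ≤ Real.exp (-(q * btLog β ^ 2)) := by
      have h0 : 0 ≤ Real.exp (-(((powScale 1 β) * btLog β) ^ 2 / powScale 1 β ^ 2)) := (Real.exp_pos _).le
      have h1 : Real.exp (-(((powScale 1 β) * btLog β) ^ 2 / powScale 1 β ^ 2)) ≤ 1 := Real.exp_le_one_iff.mpr (by rw [eτ]; linarith)
      calc _ ≤ Real.exp (-(((powScale 1 β) * btLog β) ^ 2 / powScale 1 β ^ 2)) * 1 := by rw [pow_two]; exact mul_le_mul_of_nonneg_left h1 h0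
        _ ≤ _ := by rw [mul_one]; exact e2
    have e3 : Real.exp (-(β * ((min (1 / 40) (powScale (1 / 2) β * btLog β)) / 1000) ^ 2)) ≤ Real.exp (-(q * btLog β ^ 2)) := by
      rw [Real.exp_le_exp, neg_le_neg_iff]
      have : β * ((min (1 / 40) (powScale (1 / 2) β * btLog β)) / 1000) ^ 2 = 1 / 1000000 * (β * (min (1 / 40) (powScale (1 / 2) β * btLog β)) ^ 2) := by ring
      rw [this, hrf]
      exact mul_le_mul_of_nonneg_right hq2 hℓ
    set X : ℝ := Real.exp (-(q * btLog β ^ 2)) with hX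
    have hX0 : 0 ≤ X := (Real.exp_pos _).le
    have hsum : EK ^ 2 * (Real.exp (-(β * gap * ((min (1 / 40) (powScale (1 / 2) β * btLog β)) / 12 / 2) ^ 2)) + Real.exp (-(((powScale 1 β) * btLog β) ^ 2 / powScale 1 β ^ 2)) ^ 2 +
          Real.exp (-(((powScale 1 β) * btLog β) ^ 2 / powScale 1 β ^ 2))) + EK * (EK * Real.exp (-(β * ((min (1 / 40) (powScale (1 / 2) β * btLog β)) / 1000) ^ 2))) ≤ EK ^ 2 * (4 * X) := by
      have h := add_le_add (add_le_add e1 e2') e2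
      have h4 := mul_le_mul_of_nonneg_left h (sq_nonneg EK)
      have h5 : EK * (EK * Real.exp (-(β * ((min (1 / 40) (powScale (1 / 2) β * btLog β)) / 1000) ^ 2))) ≤ EK ^ 2 * X := by
        rw [← mul_assoc, ← pow_two]; exact mul_le_mul_of_nonneg_left e3 (sq_nonneg EK)
      linarith
    have hA0 : 0 ≤ 3 * (Pm * (1 / (fpWeightBar L (powScale 1 β) * (1 - Cp * (Kc * powScale s β) ^ 2)))) := by positivity
    calc _ = 3 * (Pm * (1 / (fpWeightBar L (powScale 1 β) * (1 - Cp * (Kc * powScale s β) ^ 2)))) *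
          (EK ^ 2 * (Real.exp (-(β * gap * ((min (1 / 40) (powScale (1 / 2) β * btLog β)) / 12 / 2) ^ 2)) + Real.exp (-(((powScale 1 β) * btLog β) ^ 2 / powScale 1 β ^ 2)) ^ 2 +
            Real.exp (-(((powScale 1 β) * btLog β) ^ 2 / powScale 1 β ^ 2))) + EK * (EK * Real.exp (-(β * ((min (1 / 40) (powScale (1 / 2) β * btLog β)) / 1000) ^ 2)))) := by ring
      _ ≤ 3 * (Pm * (1 / (fpWeightBar L (powScale 1 β) * (1 - Cp * (Kc * powScale s β) ^ 2)))) * (EK ^ 2 * (4 * X)) :=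
          mul_le_mul_of_nonneg_left hsum hA0
      _ = EK ^ 2 * Q β * X := by simp only [hQ]; ring
  · -- `0 ≤ Q ≤ P/ps1^{flatDim}`
    filter_upwards [hκ] with β hκβ
    have hN : 0 < fpWeightBar L (powScale 1 β) := fpWeightBar_pos L (powScale_pos 1 β)
    have hps : 0 < powScale 1 β := powScale_pos 1 β
    have h1κ : 1 / 2 ≤ 1 - Cp * (Kc * powScale s β) ^ 2 := by linarith
    have hcg0 : 0 ≤ 1 / (fpWeightBar L (powScale 1 β) * (1 - Cp * (Kc * powScale s β) ^ 2)) := by positivity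
    have hcg : 1 / (fpWeightBar L (powScale 1 β) * (1 - Cp * (Kc * powScale s β) ^ 2)) ≤ 2 * c₀i / powScale 1 β ^ flatDim L := by
      have hi := inv_fpWeightBar_le (L := L) β
      rw [← hc₀i] at hi
      calc 1 / (fpWeightBar L (powScale 1 β) * (1 - Cp * (Kc * powScale s β) ^ 2)) ≤ 1 / (fpWeightBar L (powScale 1 β) * (1 / 2)) :=
            one_div_le_one_div_of_le (by positivity) (mul_le_mul_of_nonneg_left h1κ hN.le)
        _ = 2 * (1 / fpWeightBar L (powScale 1 β)) := by field_simp
        _ ≤ 2 * (c₀i / powScale 1 β ^ flatDim L) := by linarith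
        _ = 2 * c₀i / powScale 1 β ^ flatDim L := by ring
    refine ⟨by simp only [hQ]; positivity, ?_⟩
    calc Q β = 3 * (Pm * (1 / (fpWeightBar L (powScale 1 β) * (1 - Cp * (Kc * powScale s β) ^ 2)))) * 4 := rfl
      _ ≤ 3 * (Pm * (2 * c₀i / powScale 1 β ^ flatDim L)) * 4 := by gcongr
      _ = 3 * (Pm * (2 * c₀i)) * 4 / powScale 1 β ^ flatDim L := by field_simp


set_option maxHeartbeats 800000 in
-- explicit record expressions.
/-- ★★ **THE SHELL RATE IS `o(λ_bare)`** (see the module docstring). [cite: Luscher1983, §3] -/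
theorem shell_rate_small_sq_K (hL : 2 ≤ L) {s : ℝ} (hs : 0 < s) (Kc Cp Cq : ℝ) :
    ∀ a : ℝ, 0 < a → ∀ᶠ β : ℝ in atTop,
      8 * (fpWeightBar L (powScale 1 β) * (1 + Cp * (Kc * powScale s β) ^ 2)) * (Real.exp (-(β * (2 - 2 * Real.cos (2 * Real.pi / L)) * ((min (1 / 40) (powScale (1 / 2) β * btLog β)) / 12) ^ 2)) * (orthoTransverse L Set.univ).toReal) /
        ((1 - powScale (1 / 5) β) ^ 2 * (1 - Cq * (Kc * powScale s β) ^ 2) *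
          (∫ v, {v : Edge 3 L → Fin 3 → ℝ | ‖linkEmbed L v‖ ≤ (min (1 / 40) (powScale (1 / 2) β * btLog β)) / 12}.indicator (fun _ => (1 : ℝ)) v *
            (Real.exp (-(stiffGaussExp L (β / 2) β (linkEmbed L v))) ^ 2 * Real.exp (-(‖(gaugeModes L).starProjection (linkEmbed L v)‖ ^ 2 / powScale 1 β ^ 2))) ∂orthoTransverse L) *
          fpWeightBar L (powScale 1 β)) ≤ a * bareLambda ((L : ℝ) ^ 3 * β) ^ 2 := by
  haveI := isFiniteMeasure_orthoTransverse L
  have hE : (0 : ℝ) < Fintype.card (Edge 3 L) := by exact_mod_cast Fintype.card_pos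
  set gap : ℝ := 2 - 2 * Real.cos (2 * Real.pi / L) with hgap
  have hgap0 : 0 < gap := gap_pos L hL
  set Pm : ℝ := (orthoTransverse L Set.univ).toReal with hPm
  have hPm0 : 0 ≤ Pm := ENNReal.toReal_nonneg
  set cb : ℝ := Real.exp (-99) * ((1 / (20 * Fintype.card (Edge 3 L))) ^ 3 / 10) ^ Fintype.card (Edge 3 L) with hcb
  have hcb0 : 0 < cb := by positivity
  set m : ℕ := 6 * Fintype.card (Edge 3 L) with hm
  -- the rate as `b²` of `b = √(max 0 ·)`
  set R : ℝ → ℝ := fun β => 8 * (fpWeightBar L (powScale 1 β) * (1 + Cp * (Kc * powScale s β) ^ 2)) * (Real.exp (-(β * gap * ((min (1 / 40) (powScale (1 / 2) β * btLog β)) / 12) ^ 2)) * Pm) /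
        ((1 - powScale (1 / 5) β) ^ 2 * (1 - Cq * (Kc * powScale s β) ^ 2) *
          (∫ v, {v : Edge 3 L → Fin 3 → ℝ | ‖linkEmbed L v‖ ≤ (min (1 / 40) (powScale (1 / 2) β * btLog β)) / 12}.indicator (fun _ => (1 : ℝ)) v *
            (Real.exp (-(stiffGaussExp L (β / 2) β (linkEmbed L v))) ^ 2 * Real.exp (-(‖(gaugeModes L).starProjection (linkEmbed L v)‖ ^ 2 / powScale 1 β ^ 2))) ∂orthoTransverse L) *
          fpWeightBar L (powScale 1 β)) with hR
  set b : ℝ → ℝ := fun β => Real.sqrt (max 0 (R β)) with hb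
  have hκt : Tendsto (fun β : ℝ => (Kc * powScale s β) ^ 2) atTop (𝓝 0) := by
    have h := ((tendsto_powScale hs).const_mul Kc).pow 2
    rw [mul_zero, zero_pow two_ne_zero] at h; exact h
  have hκP : ∀ᶠ β : ℝ in atTop, Cp * (Kc * powScale s β) ^ 2 ≤ 1 / 2 := by
    have h := hκt.const_mul Cp; rw [mul_zero] at h; exact h.eventually (eventually_le_nhds (by norm_num))
  have hκQ : ∀ᶠ β : ℝ in atTop, Cq * (Kc * powScale s β) ^ 2 ≤ 1 / 2 := by
    have h := hκt.const_mul Cq; rw [mul_zero] at h; exact h.eventually (eventually_le_nhds (by norm_num))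
  have hη : ∀ᶠ β : ℝ in atTop, powScale (1 / 5) β ≤ 1 / 2 := (tendsto_powScale (σ := 1 / 5) (by norm_num)).eventually (eventually_le_nhds (by norm_num))
  have hb2 : ∀ᶠ β : ℝ in atTop, b β ^ 2 ≤ 96 * Pm / cb * Real.exp (-(gap / 144 * btLog β ^ 2)) / powScale 1 β ^ m := by
    filter_upwards [hκP, hκQ, hη, inner_mass_poly_floor (L := L), eventually_beta_mul_rf_sq] with β hκPβ hκQβ hηβ hM2 hrf
    set M2in : ℝ := ∫ v, {v : Edge 3 L → Fin 3 → ℝ | ‖linkEmbed L v‖ ≤ (min (1 / 40) (powScale (1 / 2) β * btLog β)) / 12}.indicator (fun _ => (1 : ℝ)) v *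
            (Real.exp (-(stiffGaussExp L (β / 2) β (linkEmbed L v))) ^ 2 * Real.exp (-(‖(gaugeModes L).starProjection (linkEmbed L v)‖ ^ 2 / powScale 1 β ^ 2))) ∂orthoTransverse L with hM2in
    have hps : 0 < powScale 1 β := powScale_pos 1 β
    have hfl : cb * powScale 1 β ^ m ≤ M2in := hM2
    have hfl0 : 0 < cb * powScale 1 β ^ m := by positivity
    have hM0 : 0 < M2in := lt_of_lt_of_le hfl0 hfl
    have hN : 0 < fpWeightBar L (powScale 1 β) := fpWeightBar_pos L hps
    set X : ℝ := Real.exp (-(gap / 144 * btLog β ^ 2)) with hX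
    have hG : Real.exp (-(β * gap * ((min (1 / 40) (powScale (1 / 2) β * btLog β)) / 12) ^ 2)) = X := by
      rw [hX]; congr 1
      have : β * gap * ((min (1 / 40) (powScale (1 / 2) β * btLog β)) / 12) ^ 2 = gap / 144 * (β * (min (1 / 40) (powScale (1 / 2) β * btLog β)) ^ 2) := by ring
      rw [this, hrf]
    have hrhs0 : 0 ≤ 96 * Pm / cb * X / powScale 1 β ^ m := by positivity
    rw [hb, Real.sq_sqrt (le_max_left _ _), max_le_iff]
    refine ⟨hrhs0, ?_⟩
    -- numerator ≤ `8·N̄·(3/2)·X·Pm`, denominator ≥ `(1/4)(1/2)·M2in·N̄`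
    have hnum : 8 * (fpWeightBar L (powScale 1 β) * (1 + Cp * (Kc * powScale s β) ^ 2)) * (Real.exp (-(β * gap * ((min (1 / 40) (powScale (1 / 2) β * btLog β)) / 12) ^ 2)) * Pm) ≤
        8 * (fpWeightBar L (powScale 1 β) * (3 / 2)) * (X * Pm) := by
      rw [hG]; gcongr; linarith
    have hden : (1 / 2) ^ 2 * (1 / 2) * M2in * fpWeightBar L (powScale 1 β) ≤ (1 - powScale (1 / 5) β) ^ 2 * (1 - Cq * (Kc * powScale s β) ^ 2) * M2in * fpWeightBar L (powScale 1 β) := by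
      have h1 : (1 / 2 : ℝ) ≤ 1 - powScale (1 / 5) β := by linarith
      have h2 : (1 / 2 : ℝ) ≤ 1 - Cq * (Kc * powScale s β) ^ 2 := by linarith
      have h3 : (1 / 2 : ℝ) ^ 2 ≤ (1 - powScale (1 / 5) β) ^ 2 := pow_le_pow_left₀ (by norm_num) h1 2
      exact mul_le_mul_of_nonneg_right (mul_le_mul_of_nonneg_right (mul_le_mul h3 h2 (by norm_num) (by positivity)) hM0.le) hN.le
    have hden0 : 0 < (1 / 2 : ℝ) ^ 2 * (1 / 2) * M2in * fpWeightBar L (powScale 1 β) := by positivity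
    calc R β ≤ 8 * (fpWeightBar L (powScale 1 β) * (3 / 2)) * (X * Pm) / ((1 / 2) ^ 2 * (1 / 2) * M2in * fpWeightBar L (powScale 1 β)) := by
          simp only [hR]; exact div_le_div₀ (by positivity) hnum hden0 hden
      _ = 96 * Pm * X / M2in := by field_simp; ring
      _ ≤ 96 * Pm * X / (cb * powScale 1 β ^ m) := div_le_div_of_nonneg_left (by positivity) hfl0 hfl
      _ = 96 * Pm / cb * X / powScale 1 β ^ m := by field_simp
  have hsmall := sq_rate_small_sq_of_exp_btLog_sq (L := L) (q := gap / 144) (by positivity) (P := 96 * Pm / cb) (by positivity) m (b := b)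
    (by filter_upwards [hb2] with β h; simpa [mul_div_assoc, div_div, mul_comm, mul_left_comm, mul_assoc] using h)
  intro a ha
  filter_upwards [hsmall a ha] with β hβ
  have h1 : R β ≤ b β ^ 2 := by rw [hb, Real.sq_sqrt (le_max_left _ _)]; exact le_max_right _ _
  exact h1.trans hβ

end Summit.QuantumFields.YangMills.Theorems.FemtoTransferGap.TwoLattice.ConstTube

end
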